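import Summits.ValiantsHypothesis.ValiantsHypothesis.Theorems.NcSkewStructure
import Summits.ValiantsHypothesis.ValiantsHypothesis.Theorems.NcSOSPermanent
import Mathlib
import HarnessLib

/-!
# Skew noncommutative circuits for `LID_r` and the permanent are exponential (Limaye–Malod–Srinivasan 2016)

Workshop file for the node `CommutativityDial` (decomp-valiant lens 6; O-L6-11, FILE 2 of 2; FILE 1 =
`NcSkewStructure`). SCOPE: per-circuit theorems for skew fan-in-two nc circuits; strictly below A_nc
(23446): says nothing about general fan-in-two nc circuits — one non-skew product gate defeats the
outer flattening (LMS16 §8: (PAL_{d/2})² has linear non-skew circuits) — nothing about formulas,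
nothing commutative; no item closed or restated. (Fan-in two is w.l.o.g. for skew circuits up to a
constant blow-up in size; only the fan-in-two form is treated here.)
§1 words of functions. §2 the OUTER FLATTENING `outerFlat p m f` (rows = first `p` and last `p`
letters, columns = the middle `m` letters: LMS16's matrix `M[f, Π]`, `Π = [0,p) ∪ [p+m, 2p+m)`) and
the ROW LEMMA: each row of the outer flattening of a framed body `h_r · g · h̄_{p−r}` is a multiple
of a row of the BODY MATRIX of `g`. §3 **Main Lemma 5.4** (`rank_outerFlat_le`, every field; row
spaces instead of a sum of ranks): rank `≤ |vals| · (p+1) · n^p` on the skew span of FILE 1.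
§4 `LID_r` (`lidPoly`, HWY10): its outer flattening (`p = r`, `m = 2r`) is a permutation matrix of
rank `4^r`, whence **`2^r ≤ (r+1) · size` for every fan-in-two SKEW nc circuit computing `LID_r`**
(`lidPoly_skew`; LMS16 Thm 5.5 for the lifted identity, p. 11) and, along the skewness-preserving
lifting substitution `PERM_n ↦ LID_r`, `4r ≤ n` (`perm_lift`, HWY10 Lemma C.5 in place of LMS16
Lemma 7.1), **`2^{⌊n/4⌋} ≤ (⌊n/4⌋+1) · size` for every fan-in-two SKEW nc circuit computing the
ordered permanent** (`ncPerPoly_skew_floor`; LMS16 §7); §5 the same in the binder shape of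
`PerNotNcVP` restricted to skew circuits. HONEST FRAMING: theorems in print (LMS16 Lemma 5.4, Thm 5.5, §7;
HWY10 C.5), new in the kernel only; the skew rung of the `CommutativityDial` ladder (nc ABP `NisanPermanent`
⊂ nc skew ⊂ general nc = the open `A_nc`); nothing here bears on `VP ≠ VNP`.
-/
noncomputable section

namespace Summit.ValiantsHypothesis.ValiantsHypothesis.Theorems.NcSkewPermanent

open Literature.Computability.AlgebraicComplexity Literature.Computability.AlgebraicComplexity.ArithCircuit
open Summit.ValiantsHypothesis.ValiantsHypothesis.Theorems.NcAutomatonIntersection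
  Summit.ValiantsHypothesis.ValiantsHypothesis.Theorems.NcCentralWidth
  Summit.ValiantsHypothesis.ValiantsHypothesis.Theorems.NcSOSDegreeFour
  Summit.ValiantsHypothesis.ValiantsHypothesis.Theorems.NcBlockForms
  Summit.ValiantsHypothesis.ValiantsHypothesis.Theorems.NcCayleyDeterminant
  Summit.ValiantsHypothesis.ValiantsHypothesis.Theorems.NcSOSPermanent
  Summit.ValiantsHypothesis.ValiantsHypothesis.Theorems.NcSkewStructure

universe u v

/-! ## §1 Words of functions: gluing and splitting -/

section Lists

variable {σ : Type v}

/-- A list of length `n` is `List.ofFn` of a function on `Fin n`. [cite: LimayeMalodSrinivasan2016, Lemma 5.4] -/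
theorem exists_ofFn_eq (l : List σ) {n : ℕ} (hl : l.length = n) : ∃ x : Fin n → σ, List.ofFn x = l := by
  subst hl; exact ⟨_, List.ofFn_getElem⟩

/-- The MIDDLE of a row index `(A, B)` for the left frame length `r` (`r + q = p`): the last `q`
letters of `A` and the first `r` letters of `B`. [cite: LimayeMalodSrinivasan2016, Lemma 5.4] -/
def midOf {p : ℕ} (r q : ℕ) (hrq : r + q = p) (y : (Fin p → σ) × (Fin p → σ)) :
    (Fin q → σ) × (Fin r → σ) :=
  (fun i => y.1 ⟨r + i.val, by have := i.isLt; omega⟩, fun i => y.2 ⟨i.val, by have := i.isLt; omega⟩)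

/-- The first middle block is `A` with its first `r` letters dropped. [cite: LimayeMalodSrinivasan2016, Lemma 5.4] -/
theorem ofFn_midOf_fst {p r q : ℕ} (hrq : r + q = p) (y : (Fin p → σ) × (Fin p → σ)) :
    List.ofFn (midOf r q hrq y).1 = (List.ofFn y.1).drop r := by
  apply List.ext_getElem
  · simp only [List.length_ofFn, List.length_drop]; omega
  · intro i h₁ h₂; simp only [List.getElem_ofFn, List.getElem_drop, midOf]

/-- The second middle block is the first `r` letters of `B`. [cite: LimayeMalodSrinivasan2016, Lemma 5.4] -/
theorem ofFn_midOf_snd {p r q : ℕ} (hrq : r + q = p) (y : (Fin p → σ) × (Fin p → σ)) :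
    List.ofFn (midOf r q hrq y).2 = (List.ofFn y.2).take r := by
  apply List.ext_getElem
  · simp only [List.length_ofFn, List.length_take]; omega
  · intro i h₁ h₂; simp only [List.getElem_ofFn, List.getElem_take, midOf]

/-- The `2r`-periodic word of `e` is `e e`. [cite: HrubesWigdersonYehudayoff2010, Cor. C.4] -/
theorem ofFn_periodic (r : ℕ) (e : Fin (2 * r) → σ) :
    (List.ofFn fun p : Fin (4 * r) =>
        e ⟨p.val % (2 * r), Nat.mod_lt _ (by have := p.isLt; omega)⟩) =
      List.ofFn e ++ List.ofFn e := by
  apply List.ext_getElem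
  · simp only [List.length_ofFn, List.length_append]; omega
  · intro i h₁ h₂
    simp only [List.length_ofFn, List.length_append] at h₁ h₂
    simp only [List.getElem_ofFn, List.getElem_append, List.length_ofFn]
    split_ifs with hi
    · exact congrArg e (Fin.ext (Nat.mod_eq_of_lt hi))
    · exact congrArg e (Fin.ext (by dsimp only; rw [Nat.mod_eq_sub_mod (by omega), Nat.mod_eq_of_lt (by omega)]))

/-- GLUING: `e e = A · C · B` (`|A| = |B| = r`, `|C| = |e| = 2r`) iff `C = B A` and `e = A B`.
[cite: LimayeMalodSrinivasan2016, §5 (remark on `LID_r`)] -/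
theorem glue_eq_iff {r : ℕ} (A B : Fin r → σ) (C e : Fin (2 * r) → σ) :
    List.ofFn e ++ List.ofFn e = List.ofFn A ++ List.ofFn C ++ List.ofFn B ↔
      List.ofFn C = List.ofFn B ++ List.ofFn A ∧ List.ofFn e = List.ofFn A ++ List.ofFn B := by
  have hC : List.ofFn C = (List.ofFn C).take r ++ (List.ofFn C).drop r :=
    (List.take_append_drop r (List.ofFn C)).symm
  have hl1 : ((List.ofFn C).take r).length = r := by simp only [List.length_take, List.length_ofFn]; omega
  have hl2 : ((List.ofFn C).drop r).length = r := by simp only [List.length_drop, List.length_ofFn]; omega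
  constructor
  · intro H
    rw [hC, show List.ofFn A ++ ((List.ofFn C).take r ++ (List.ofFn C).drop r) ++ List.ofFn B =
      (List.ofFn A ++ (List.ofFn C).take r) ++ ((List.ofFn C).drop r ++ List.ofFn B) by
        simp only [List.append_assoc]] at H
    obtain ⟨h1, h2⟩ := List.append_inj H
      (by simp only [List.length_append, List.length_ofFn, hl1]; omega)
    obtain ⟨h3, h4⟩ := List.append_inj (h1.symm.trans h2) (by simp only [List.length_ofFn, hl2])
    exact ⟨by rw [hC, h4, ← h3], by rw [h1, h4]⟩
  · rintro ⟨hC', he⟩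
    rw [he, hC']
    simp only [List.append_assoc]

end Lists

/-! ## §2 The outer flattening and the row lemma -/

section Flat

variable (K : Type u) [Field K] {σ : Type v}

/-- The OUTER FLATTENING `M[f, Π]`, `Π : Y = [0,p) ∪ [p+m,2p+m)`: rows `(A, B)` = the outer letters,
columns `C` = the middle letters, entry `[A C B] f`; linear in `f`.
[cite: LimayeMalodSrinivasan2016, §3 (partial derivative matrix), Lemma 5.4] -/
def outerFlat (p m : ℕ) :
    FreeAlgebra K σ →ₗ[K] Matrix ((Fin p → σ) × (Fin p → σ)) (Fin m → σ) K where
  toFun f := fun y C => coeff (List.ofFn y.1 ++ List.ofFn C ++ List.ofFn y.2) f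
  map_add' f g := by funext y C; simp only [map_add]; rfl
  map_smul' c f := by funext y C; simp only [map_smul, smul_eq_mul, RingHom.id_apply]; rfl

/-- The entry `((A, B), C)` of the outer flattening is the coefficient `[A C B] f`. [cite: LimayeMalodSrinivasan2016, Lemma 5.4] -/
theorem outerFlat_apply (p m : ℕ) (f : FreeAlgebra K σ) (A B : Fin p → σ) (C : Fin m → σ) :
    outerFlat K p m f (A, B) C = coeff (List.ofFn A ++ List.ofFn C ++ List.ofFn B) f := rfl

/-- The BODY MATRIX of `g` read with a left gap of `q` letters and a right gap of `r` letters.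
[cite: LimayeMalodSrinivasan2016, Lemma 5.4] -/
def bodyMat (m r q : ℕ) (g : FreeAlgebra K σ) : Matrix ((Fin q → σ) × (Fin r → σ)) (Fin m → σ) K :=
  fun x C => coeff (List.ofFn x.1 ++ List.ofFn C ++ List.ofFn x.2) g

variable [DecidableEq σ]

/-- **ROW LEMMA** (one term of LMS16's Main Lemma 5.4): the row `(A, B)` of the outer flattening of a
framed body `h_r · g · h̄_q` (`r + q = p`) is `[A|_{<r}] h · [B|_{≥r}] h̄` times the row
`(A|_{≥r}, B|_{<r})` of the body matrix of `g`. [cite: LimayeMalodSrinivasan2016, Lemma 5.4] -/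
theorem outerFlat_framed_row {p m r q d : ℕ} (hrq : r + q = p) (hd : p + m + p ≤ d)
    {h g hb : FreeAlgebra K σ} (hh : degPart d r h = h) (hg : degPart d (q + m + r) g = g)
    (hhb : degPart d q hb = hb) (y : (Fin p → σ) × (Fin p → σ)) :
    outerFlat K p m (h * g * hb) y =
      (coeff ((List.ofFn y.1).take r) h * coeff ((List.ofFn y.2).drop r) hb) •
        bodyMat K m r q g (midOf r q hrq y) := by
  funext C
  rw [Pi.smul_apply, smul_eq_mul]
  show coeff (List.ofFn y.1 ++ List.ofFn C ++ List.ofFn y.2) (h * g * hb) = _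
  have hbody : bodyMat K m r q g (midOf r q hrq y) C =
      coeff ((List.ofFn y.1).drop r ++ List.ofFn C ++ (List.ofFn y.2).take r) g := by
    simp only [bodyMat, ofFn_midOf_fst, ofFn_midOf_snd]
  -- first cut: `(h g) · h̄` at `r + (q + m + r)`
  have hhg : degPart d (r + (q + m + r)) (h * g) = h * g := degPart_mul_of_eq hh hg (by omega)
  have hw : (List.ofFn y.1 ++ List.ofFn C ++ List.ofFn y.2).length = r + (q + m + r) + q := by
    simp only [List.length_append, List.length_ofFn]; omega
  have step1 := coeff_mul_degPart (d := d) (a := r + (q + m + r)) (b := q) (by omega) _ hw (h * g) hb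
  rw [hhg, hhb] at step1
  have htake1 : (List.ofFn y.1 ++ List.ofFn C ++ List.ofFn y.2).take (r + (q + m + r)) =
      List.ofFn y.1 ++ List.ofFn C ++ (List.ofFn y.2).take r := by
    rw [List.take_append, List.take_of_length_le (l := List.ofFn y.1 ++ List.ofFn C)
      (i := r + (q + m + r)) (by simp only [List.length_append, List.length_ofFn]; omega),
      show r + (q + m + r) - (List.ofFn y.1 ++ List.ofFn C).length = r by
        simp only [List.length_append, List.length_ofFn]; omega]
  have hdrop1 : (List.ofFn y.1 ++ List.ofFn C ++ List.ofFn y.2).drop (r + (q + m + r)) =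
      (List.ofFn y.2).drop r := by
    rw [List.drop_append, List.drop_of_length_le (l := List.ofFn y.1 ++ List.ofFn C)
      (i := r + (q + m + r)) (by simp only [List.length_append, List.length_ofFn]; omega),
      List.nil_append, show r + (q + m + r) - (List.ofFn y.1 ++ List.ofFn C).length = r by
        simp only [List.length_append, List.length_ofFn]; omega]
  rw [htake1, hdrop1] at step1
  -- second cut: `h · g` at `r`
  have hw2 : (List.ofFn y.1 ++ List.ofFn C ++ (List.ofFn y.2).take r).length = r + (q + m + r) := by
    simp only [List.length_append, List.length_ofFn, List.length_take]; omega
  have step2 := coeff_mul_degPart (d := d) (a := r) (b := q + m + r) (by omega) _ hw2 h g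
  rw [hh, hg] at step2
  have htake2 : (List.ofFn y.1 ++ List.ofFn C ++ (List.ofFn y.2).take r).take r =
      (List.ofFn y.1).take r := by
    rw [List.take_append_of_le_length (by simp only [List.length_append, List.length_ofFn]; omega),
      List.take_append_of_le_length (by simp only [List.length_ofFn]; omega)]
  have hdrop2 : (List.ofFn y.1 ++ List.ofFn C ++ (List.ofFn y.2).take r).drop r =
      (List.ofFn y.1).drop r ++ List.ofFn C ++ (List.ofFn y.2).take r := by
    rw [List.drop_append_of_le_length (by simp only [List.length_append, List.length_ofFn]; omega),
      List.drop_append_of_le_length (by simp only [List.length_ofFn]; omega)]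
  rw [htake2, hdrop2] at step2
  rw [step1, step2, hbody]
  ring

/-- **ROWS OF A SKEW SPAN**: every row of the outer flattening (`d = 2p + m`, body degree `p + m`)
of a member of the skew span over `vals` lies in any submodule containing the rows of the body
matrices of the bodies. [cite: LimayeMalodSrinivasan2016, Lemma 5.4] -/
theorem rows_mem {p m d : ℕ} (hd : p + m + p = d) (vals : List (FreeAlgebra K σ))
    {f : FreeAlgebra K σ} (hf : f ∈ skewSpan (bodies vals d (p + m)) d (p + m) d)
    (W : Submodule K ((Fin m → σ) → K))
    (hW : ∀ v ∈ vals, ∀ (r q : ℕ) (hrq : r + q = p) (x : (Fin q → σ) × (Fin r → σ)),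
      bodyMat K m r q (degPart d (p + m) v) x ∈ W) :
    ∀ y, outerFlat K p m f y ∈ W := by
  unfold skewSpan at hf
  induction hf using Submodule.span_induction with
  | mem x hx =>
    obtain ⟨r, g, h, hb, ⟨v, hv, rfl⟩, her, hh, hhb, rfl⟩ := hx
    intro y
    have hg' : degPart d (p - r + m + r) (degPart d (p + m) v) = degPart d (p + m) v := by
      rw [show p - r + m + r = p + m by omega]; exact degPart_idem d (p + m) v
    have hhb' : degPart d (p - r) hb = hb := by
      rwa [show d - (p + m) - r = p - r by omega] at hhb
    rw [outerFlat_framed_row K (by omega : r + (p - r) = p) hd.le hh hg' hhb' y]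
    exact W.smul_mem _ (hW v hv r (p - r) (by omega) _)
  | zero => intro y; rw [map_zero]; exact W.zero_mem
  | add f g _ _ hf hg => intro y; rw [map_add]; exact W.add_mem (hf y) (hg y)
  | smul c f _ hf => intro y; rw [map_smul]; exact W.smul_mem c (hf y)

variable [Fintype σ]

/-- **MAIN LEMMA 5.4 in the kernel** (the LRM partition `[0,p) ∪ [p+m, 2p+m)`, every field): the
outer flattening of a member of the skew span over `vals` — in particular of the value of a
fan-in-two skew circuit with `|vals| = size` (FILE 1, `skew_structure`) — has rank
`≤ |vals| · (p+1) · n^p`. [cite: LimayeMalodSrinivasan2016, Lemma 5.4] -/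
theorem rank_outerFlat_le {p m d : ℕ} (hd : p + m + p = d) (vals : List (FreeAlgebra K σ))
    {f : FreeAlgebra K σ} (hf : f ∈ skewSpan (bodies vals d (p + m)) d (p + m) d) :
    (outerFlat K p m f).rank ≤ vals.length * (p + 1) * Fintype.card σ ^ p := by
  classical
  -- the dictionary of body rows: (which value, left frame length `r`, middle row index)
  let Φ : Fin vals.length × ((r : Fin (p + 1)) × ((Fin (p - r.val) → σ) × (Fin r.val → σ))) →
      (Fin m → σ) → K := fun j =>
    bodyMat K m j.2.1.val (p - j.2.1.val) (degPart d (p + m) vals[j.1]) j.2.2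
  have hrows : ∀ y, outerFlat K p m f y ∈ Submodule.span K (Set.range Φ) := by
    refine rows_mem K hd vals hf _ fun v hv r q hrq x => ?_
    obtain ⟨i, hi, rfl⟩ := List.mem_iff_getElem.1 hv
    have hr : r < p + 1 := by omega
    obtain rfl : q = p - r := by omega
    exact Submodule.subset_span ⟨⟨⟨i, hi⟩, ⟨r, hr⟩, x⟩, rfl⟩
  have hcard : Fintype.card (Fin vals.length × ((r : Fin (p + 1)) ×
      ((Fin (p - r.val) → σ) × (Fin r.val → σ)))) = vals.length * ((p + 1) * Fintype.card σ ^ p) := by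
    simp only [Fintype.card_prod, Fintype.card_sigma, Fintype.card_fun, Fintype.card_fin]
    congr 1
    rw [Finset.sum_congr rfl fun (r : Fin (p + 1)) _ =>
      show Fintype.card σ ^ (p - r.val) * Fintype.card σ ^ r.val = Fintype.card σ ^ p by
        rw [← pow_add, Nat.sub_add_cancel (Nat.le_of_lt_succ r.isLt)],
      Finset.sum_const, Finset.card_univ, Fintype.card_fin, smul_eq_mul]
  calc (outerFlat K p m f).rank
      = Module.finrank K (Submodule.span K (Set.range (outerFlat K p m f).row)) :=
        Matrix.rank_eq_finrank_span_row _
    _ ≤ Module.finrank K (Submodule.span K (Set.range Φ)) := by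
        apply Submodule.finrank_mono
        exact Submodule.span_le.2 (by rintro _ ⟨y, rfl⟩; exact hrows y)
    _ ≤ _ := finrank_range_le_card (R := K) Φ
    _ = vals.length * (p + 1) * Fintype.card σ ^ p := by rw [hcard, mul_assoc]

end Flat

/-! ## §4 `LID_r` and the permanent -/

section LID

variable (K : Type u) [Field K]

/-- The outer flattening (`p = r`, `m = 2r`) of `LID_r = Σ_e e e` is the permutation matrix
`(A, B) ↦ B A`. [cite: LimayeMalodSrinivasan2016, §5 (remark on `LID_r`)] -/
theorem outerFlat_lidPoly (r : ℕ) (A B : Fin r → Fin 2) (C : Fin (2 * r) → Fin 2) :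
    outerFlat K r (2 * r) (lidPoly K r) (A, B) C =
      if List.ofFn C = List.ofFn B ++ List.ofFn A then 1 else 0 := by
  obtain ⟨e₀, he₀⟩ := exists_ofFn_eq (List.ofFn A ++ List.ofFn B) (n := 2 * r)
    (by simp only [List.length_append, List.length_ofFn]; omega)
  have key : ∀ e : Fin (2 * r) → Fin 2,
      outerFlat K r (2 * r) (((List.ofFn fun p : Fin (4 * r) =>
        e ⟨p.val % (2 * r), Nat.mod_lt _ (by have := p.isLt; omega)⟩).map
          (FreeAlgebra.ι K)).prod) (A, B) C =
        if List.ofFn C = List.ofFn B ++ List.ofFn A ∧ e = e₀ then 1 else 0 := by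
    intro e
    rw [outerFlat_apply, ofFn_periodic r e, coeff_word]
    simp only [glue_eq_iff, ← he₀, List.ofFn_inj]
  unfold lidPoly
  rw [map_sum, Matrix.sum_apply, Finset.sum_congr rfl fun e _ => key e]
  by_cases hC : List.ofFn C = List.ofFn B ++ List.ofFn A
  · simp only [hC, true_and, Finset.sum_ite_eq', Finset.mem_univ, if_true]
  · simp only [hC, false_and, if_false, Finset.sum_const_zero]

/-- `M · Mᵀ = 1` for the outer flattening `M` of `LID_r`. [cite: LimayeMalodSrinivasan2016, §5 (remark on `LID_r`)] -/
theorem outerFlat_lidPoly_mul_transpose (r : ℕ) :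
    outerFlat K r (2 * r) (lidPoly K r) * (outerFlat K r (2 * r) (lidPoly K r)).transpose = 1 := by
  ext y y'
  obtain ⟨A, B⟩ := y
  obtain ⟨A', B'⟩ := y'
  obtain ⟨C₀, hC₀⟩ := exists_ofFn_eq (List.ofFn B ++ List.ofFn A) (n := 2 * r)
    (by simp only [List.length_append, List.length_ofFn]; omega)
  have h1 : ∀ C : Fin (2 * r) → Fin 2, List.ofFn C = List.ofFn B ++ List.ofFn A ↔ C = C₀ :=
    fun C => by rw [← hC₀, List.ofFn_inj]
  rw [Matrix.mul_apply, Matrix.one_apply]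
  simp only [Matrix.transpose_apply, outerFlat_lidPoly, h1, ite_mul, one_mul, zero_mul,
    Finset.sum_ite_eq', Finset.mem_univ, if_true]
  rw [hC₀]
  by_cases hAB : (A, B) = (A', B')
  · cases hAB
    simp only [if_true]
  · rw [if_neg hAB, if_neg]
    intro H
    obtain ⟨hB, hA⟩ := List.append_inj H (by simp only [List.length_ofFn])
    exact hAB (by rw [List.ofFn_injective hA, List.ofFn_injective hB])

/-- `4^r = 2^r · 2^r`. [cite: LimayeMalodSrinivasan2016, Thm 5.5] -/
theorem four_pow_eq_mul (r : ℕ) : (4 : ℕ) ^ r = 2 ^ r * 2 ^ r := by rw [← mul_pow]; norm_num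

/-- The outer flattening of `LID_r` (`4^r × 4^r`) has full rank `4^r`. [cite: LimayeMalodSrinivasan2016, §5 (remark on `LID_r`)] -/
theorem rank_outerFlat_lidPoly (r : ℕ) : (outerFlat K r (2 * r) (lidPoly K r)).rank = 4 ^ r := by
  have hcard : Fintype.card ((Fin r → Fin 2) × (Fin r → Fin 2)) = 4 ^ r := by
    simp only [Fintype.card_prod, Fintype.card_fun, Fintype.card_fin]
    exact (four_pow_eq_mul r).symm
  apply le_antisymm
  · exact (Matrix.rank_le_card_height _).trans hcard.le
  · have h := Matrix.rank_mul_le_left (outerFlat K r (2 * r) (lidPoly K r))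
      (outerFlat K r (2 * r) (lidPoly K r)).transpose
    rwa [outerFlat_lidPoly_mul_transpose, Matrix.rank_one, hcard] at h

/-- **`LID_r` IS EXPONENTIALLY HARD FOR SKEW CIRCUITS** (LMS16 Thm 5.5 for the lifted identity,
explicit): every fan-in-two skew noncommutative circuit computing `LID_r`, `r ≥ 1`, has
`2^r ≤ (r+1) · size`. [cite: LimayeMalodSrinivasan2016, Thm 5.5, §5 (remark on `LID_r`)] -/
theorem lidPoly_skew {r : ℕ} (hr : 1 ≤ r) (P : ArithCircuit K (Fin 2)) (h2 : P.IsFanInTwo)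
    (hs : P.IsSkew) (h : P.ncEval = lidPoly K r) : 2 ^ r ≤ (r + 1) * P.size := by
  have hmem : lidPoly K r ∈
      skewSpan (bodies (ncGateValues P.gates) (4 * r) (r + 2 * r)) (4 * r) (r + 2 * r) (4 * r) := by
    have := skew_structure P h2 hs (d := 4 * r) (e := r + 2 * r) (by omega) (by omega)
      (by rw [h]; exact degPart_lidPoly K r)
    rwa [h] at this
  have hrank := rank_outerFlat_le K (p := r) (m := 2 * r) (d := 4 * r) (by omega)
    (ncGateValues P.gates) hmem
  have hlen : (ncGateValues P.gates).length = P.size := by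
    show _ = P.gates.length
    simpa using (ncGateValues_append_getD P.gates []).1
  rw [hlen, Fintype.card_fin] at hrank
  have h4 : 2 ^ r * 2 ^ r ≤ (r + 1) * P.size * 2 ^ r :=
    calc 2 ^ r * 2 ^ r = 4 ^ r := (four_pow_eq_mul r).symm
      _ = (outerFlat K r (2 * r) (lidPoly K r)).rank := (rank_outerFlat_lidPoly K r).symm
      _ ≤ P.size * (r + 1) * 2 ^ r := hrank
      _ = (r + 1) * P.size * 2 ^ r := by ring
  exact Nat.le_of_mul_le_mul_right h4 (by positivity)

/-- **THE ORDERED PERMANENT IS EXPONENTIALLY HARD FOR SKEW CIRCUITS** (LMS16 §7, via HWY's lifting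
substitution Lemma C.5): every fan-in-two skew noncommutative circuit computing `PERM_n`, `4r ≤ n`,
`r ≥ 1`, has `2^r ≤ (r+1) · size` (the lift is HWY's Lemma C.5, `perm_lift`). [cite: LimayeMalodSrinivasan2016, §7] -/
theorem ncPerPoly_skew {r n : ℕ} (hr : 1 ≤ r) (hn : 4 * r ≤ n) (P : ArithCircuit K (Fin n × Fin n))
    (h2 : P.IsFanInTwo) (hs : P.IsSkew) (h : P.ncEval = ncPerPoly K n) :
    2 ^ r ≤ (r + 1) * P.size := by
  have hQ : (P.substIn (liftSubst K r n)).ncEval = lidPoly K r := by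
    rw [ncEval_substIn, h, perm_lift K hn]
  have := lidPoly_skew K hr (P.substIn (liftSubst K r n)) (h2.substIn _) (hs.substIn _) hQ
  rwa [size_substIn] at this

/-- The same with `r = ⌊n/4⌋`: `2^{⌊n/4⌋} ≤ (⌊n/4⌋ + 1) · size`, every `n ≥ 4`.
[cite: LimayeMalodSrinivasan2016, §7] -/
theorem ncPerPoly_skew_floor {n : ℕ} (hn : 4 ≤ n) (P : ArithCircuit K (Fin n × Fin n))
    (h2 : P.IsFanInTwo) (hs : P.IsSkew) (h : P.ncEval = ncPerPoly K n) :
    2 ^ (n / 4) ≤ (n / 4 + 1) * P.size :=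
  ncPerPoly_skew K (r := n / 4) (by omega) (Nat.mul_div_le n 4) P h2 hs h

end LID

/-! ## §5 The binder shape of `PerNotNcVP`, restricted to skew circuits -/

/-- Growth bookkeeping: `(m+1)·((4m)^c + c) < 2^m` for `m = 2^{4c+6}`. [cite: LimayeMalodSrinivasan2016, §7] -/
theorem skew_growth (c : ℕ) : ∃ m : ℕ, 1 ≤ m ∧ (m + 1) * ((4 * m) ^ c + c) < 2 ^ m := by
  have h1 : 2 * c + 3 < 2 ^ (2 * c + 3) := Nat.lt_two_pow_self
  have h2 : 4 * c ^ 2 + 13 * c + 8 ≤ 2 ^ ((2 * c + 3) * 2) :=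
    calc 4 * c ^ 2 + 13 * c + 8 ≤ (2 * c + 4) ^ 2 := by nlinarith
      _ ≤ (2 ^ (2 * c + 3)) ^ 2 := Nat.pow_le_pow_left (by omega) 2
      _ = 2 ^ ((2 * c + 3) * 2) := (pow_mul 2 (2 * c + 3) 2).symm
  refine ⟨2 ^ ((2 * c + 3) * 2), Nat.one_le_two_pow, ?_⟩
  generalize hk : (2 * c + 3) * 2 = k at h2 ⊢
  have hE : k + 1 + (c + (k + 2) * c) < 2 ^ k := by subst hk; nlinarith [h2]
  have hc1 : c + 1 ≤ 2 ^ c := Nat.lt_two_pow_self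
  have hm1 : 1 ≤ 2 ^ k := Nat.one_le_two_pow
  have hX : 1 ≤ (4 * 2 ^ k) ^ c := Nat.one_le_pow _ _ (by positivity)
  calc (2 ^ k + 1) * ((4 * 2 ^ k) ^ c + c)
      ≤ 2 ^ (k + 1) * (2 ^ c * (4 * 2 ^ k) ^ c) := by
        apply Nat.mul_le_mul
        · rw [pow_succ]; omega
        · have := Nat.mul_le_mul_left c hX
          calc (4 * 2 ^ k) ^ c + c ≤ (c + 1) * (4 * 2 ^ k) ^ c := by rw [add_mul, one_mul]; omega
            _ ≤ 2 ^ c * (4 * 2 ^ k) ^ c := Nat.mul_le_mul_right _ hc1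
    _ = 2 ^ (k + 1 + (c + (k + 2) * c)) := by
        rw [show (4 : ℕ) * 2 ^ k = 2 ^ (k + 2) by ring, ← pow_mul, ← pow_add, ← pow_add]
    _ < 2 ^ 2 ^ k := Nat.pow_lt_pow_right (by norm_num) hE

/-- (ε) **The i.o. rung in the binder shape of `PerNotNcVP`, for SKEW circuits**: for every `c`
some ordered permanent needs fan-in-two skew noncommutative circuits of size `> n^c + c`
(`n = 4 · 2^{4c+6}` will do). Says nothing about non-skew circuits. [cite: LimayeMalodSrinivasan2016, §7] -/
theorem perNotNcSkewVP (c : ℕ) : ∃ n : ℕ, ∀ P : ArithCircuit ℂ (Fin n × Fin n), P.IsFanInTwo →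
    P.IsSkew → P.ncEval = ncPerPoly ℂ n → n ^ c + c < P.size := by
  obtain ⟨m, hm, hlt⟩ := skew_growth c
  refine ⟨4 * m, fun P h2 hs h => ?_⟩
  have hle := ncPerPoly_skew ℂ hm le_rfl P h2 hs h
  by_contra hcon
  have := Nat.mul_le_mul_left (m + 1) (Nat.not_lt.1 hcon)
  omega

end Summit.ValiantsHypothesis.ValiantsHypothesis.Theorems.NcSkewPermanent

end
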